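import Mathlib.Data.ZMod.Basic
import Mathlib.Algebra.BigOperators.Ring.Finset
import Mathlib.Algebra.Group.Nat.Even
import HarnessLib

/-!
# The triangle (cycle GHZ) game cannot be won by local strategies

Trunk `CryptoQuantFine` / family `quantum-advantage`: the classical impossibility statement
behind Bravyi–Gosset–König's separation (*Quantum advantage with shallow circuits*, Science 362
(2018), arXiv:1704.00690, §4.1, Lemma 3 with Claims 3–4), in a purely combinatorial,
deterministic form.

## Informal content

Positions `j : J` of an even cycle carry a class `cls j : Option (Fin 3)`: `none` for the even
positions (the three hubs `u, v, w` and the even vertices of the sides), `some a` for an odd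
position lying on the side of the triangle *opposite* to hub `a` (BGK Fig. 3: `R` is opposite
`u = 0`, `B` opposite `v = 1`, `L` opposite `w = 2`). For an output string `w : J → Bool` and an
input `β : Fin 3 → Bool` (the bits `b_u b_v b_w`), the measurement statistics of the cycle graph
state force (BGK Claim 3, rewritten additively with `m_j = (-1)^{w_j}`):

* `oddSum`: `Σ_{j odd} w_j = 0 (mod 2)` (BGK: `m_R m_B m_L = 1`);
* `arcSum`: if `|β|` is even, `Σ_{j even} w_j + Σ_{a : β_a = 1} Σ_{j ∈ arc a, odd} w_j = [β ≠ 0]`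
  (BGK Eq. (14): the four stabilisers for `β ∈ {000, 110, 101, 011}`).

`GameOK cls β w` is the conjunction of these constraints. The theorem `game_unwinnable` says: if
each output bit `z_β(j)` depends on at most one input bit `β (dep j)`, and an odd position on the
side opposite hub `a` never depends on `β_a` (BGK: "each output bit depends only on the nearest
input bit"), then `z_β` violates `GameOK` for some `β`. BGK prove this via Claim 4 (a bound on an
exponential sum over affine functions, checked by computer); here it is the elementary
observation that the six constraints for `β = 000, 111` (odd sums) and `β = 000, 110, 101, 011`
(arc sums) add up to `0 = 1` position by position.

## References

* S. Bravyi, D. Gosset, R. König, *Quantum advantage with shallow circuits*, Science 362 (2018)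
  308–311, arXiv:1704.00690, §4.1 (Lemma 3, Claims 3, 4, Appendix B).
* J. Barrett, C. Caves, B. Eastin, M. Elliott, S. Pironio, *Modeling Pauli measurements on graph
  states with nearest-neighbor classical communication*, Phys. Rev. A 75 (2007) 012103 (the
  original cycle game).
-/

namespace Literature.Computability.QuantumComplexity

open Finset

variable {J : Type*} [Fintype J]

/-- The odd-position parity of an output string: `Σ_{j : cls j ≠ none} w_j (mod 2)`
(BGK Claim 3: `m_R m_B m_L = (-1)^{oddSum}`). [cite: BravyiGossetKonigScience2018, §4.1 Claim 3] -/
def oddSum (cls : J → Option (Fin 3)) (w : J → Bool) : ZMod 2 :=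
  ∑ j, if cls j ≠ none ∧ w j = true then 1 else 0

/-- The setting-dependent parity of an output string: the sum of `w_j` over the even positions
and over the odd positions of the sides opposite to the hubs `a` with `β_a = 1`
(BGK Claim 3, Eq. (14): `m_u m_v m_w m_E m_R^{b_u} m_B^{b_v} m_L^{b_w} = (-1)^{arcSum}`). [cite: BravyiGossetKonigScience2018, §4.1 Claim 3] -/
def arcSum (cls : J → Option (Fin 3)) (β : Fin 3 → Bool) (w : J → Bool) : ZMod 2 :=
  ∑ j, if (cls j = none ∨ ∃ a, cls j = some a ∧ β a = true) ∧ w j = true then 1 else 0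

/-- The constraints satisfied by every possible outcome `w` of the cycle experiment with
settings `β` (BGK Claim 3): the odd parity vanishes, and for settings of even weight the
setting-dependent parity equals `[β ≠ 000]` (from `i^{|β|} = ±1`). [cite: BravyiGossetKonigScience2018, §4.1 Claim 3] -/
def GameOK (cls : J → Option (Fin 3)) (β : Fin 3 → Bool) (w : J → Bool) : Prop :=
  oddSum cls w = 0 ∧
    (Even (univ.filter fun a => β a = true).card →
      arcSum cls β w = if ∃ a, β a = true then 1 else 0)

namespace Game

/-- The value of a one-bit strategy: reads bit `d` of the setting and answers `Zt`/`Zf`. [folklore] -/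
def zval (d : Fin 3) (Zf Zt : Bool) (β : Fin 3 → Bool) : Bool := if β d = true then Zt else Zf

/-- The setting `000`. [folklore] -/
def β000 : Fin 3 → Bool := fun _ => false
/-- The setting `111`. [folklore] -/
def β111 : Fin 3 → Bool := fun _ => true
/-- The setting `110` (`b_u = b_v = 1`). [folklore] -/
def β110 : Fin 3 → Bool := fun i => decide (i ≠ 2)
/-- The setting `101` (`b_u = b_w = 1`). [folklore] -/
def β101 : Fin 3 → Bool := fun i => decide (i ≠ 1)
/-- The setting `011` (`b_v = b_w = 1`). [folklore] -/
def β011 : Fin 3 → Bool := fun i => decide (i ≠ 0)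

/-- The total contribution of one position (class `c`, read bit `d`, answers `Zf`, `Zt`) to the
six constraints `oddSum` at `000`, `111` and `arcSum` at `000`, `110`, `101`, `011`. [folklore] -/
def tot (c : Option (Fin 3)) (d : Fin 3) (Zf Zt : Bool) : ZMod 2 :=
  (if c ≠ none ∧ zval d Zf Zt β000 = true then 1 else 0) +
  (if c ≠ none ∧ zval d Zf Zt β111 = true then 1 else 0) +
  (if (c = none ∨ ∃ a, c = some a ∧ β000 a = true) ∧ zval d Zf Zt β000 = true then 1 else 0) +
  (if (c = none ∨ ∃ a, c = some a ∧ β110 a = true) ∧ zval d Zf Zt β110 = true then 1 else 0) +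
  (if (c = none ∨ ∃ a, c = some a ∧ β101 a = true) ∧ zval d Zf Zt β101 = true then 1 else 0) +
  (if (c = none ∨ ∃ a, c = some a ∧ β011 a = true) ∧ zval d Zf Zt β011 = true then 1 else 0)

/-- Position by position, the six constraints cancel for every admissible local strategy. [folklore] -/
theorem tot_eq_zero : ∀ (c : Option (Fin 3)) (d : Fin 3) (Zf Zt : Bool),
    (∀ a, c = some a → d ≠ a) → tot c d Zf Zt = 0 := by
  decide

end Game

open Game in
/-- **The cycle game is not winnable by one-bit-local strategies** (Bravyi–Gosset–König 2018,
Lemma 3 / Claim 4, deterministic core). Let `z β : J → Bool` be the answer to the setting `β`,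
where position `j` reads only the bit `β (dep j)`, and an odd position on the side opposite hub
`a` does not read `β_a`. Then the constraints `GameOK` fail for some setting `β`. [cite: BravyiGossetKonigScience2018, §4.1 Lemma 3] -/
theorem game_unwinnable (cls : J → Option (Fin 3)) (dep : J → Fin 3)
    (z : (Fin 3 → Bool) → J → Bool)
    (hdep : ∀ β β' j, β (dep j) = β' (dep j) → z β j = z β' j)
    (hcls : ∀ j a, cls j = some a → dep j ≠ a) :
    ¬ ∀ β, GameOK cls β (z β) := by
  intro h
  -- every answer is a one-bit strategy
  have hz : ∀ β j, z β j = zval (dep j) (z β000 j) (z β111 j) β := by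
    intro β j
    unfold zval
    by_cases hb : β (dep j) = true
    · rw [if_pos hb]; exact hdep β β111 j (by simp [hb, β111])
    · rw [if_neg hb]; exact hdep β β000 j (by simpa [β000] using hb)
  have e1 : oddSum cls (z β000) = 0 := (h β000).1
  have e2 : oddSum cls (z β111) = 0 := (h β111).1
  have e3 : arcSum cls β000 (z β000) = 0 := by
    rw [(h β000).2 (by decide)]; decide
  have e4 : arcSum cls β110 (z β110) = 1 := by
    rw [(h β110).2 (by decide)]; decide
  have e5 : arcSum cls β101 (z β101) = 1 := by
    rw [(h β101).2 (by decide)]; decide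
  have e6 : arcSum cls β011 (z β011) = 1 := by
    rw [(h β011).2 (by decide)]; decide
  have hsum : oddSum cls (z β000) + oddSum cls (z β111) + arcSum cls β000 (z β000) +
      arcSum cls β110 (z β110) + arcSum cls β101 (z β101) + arcSum cls β011 (z β011) =
      ∑ j, tot (cls j) (dep j) (z β000 j) (z β111 j) := by
    simp only [oddSum, arcSum, ← Finset.sum_add_distrib]
    refine Finset.sum_congr rfl fun j _ => ?_
    simp only [tot, ← hz]
  have htot : ∑ j, tot (cls j) (dep j) (z β000 j) (z β111 j) = 0 :=
    Finset.sum_eq_zero fun j _ => tot_eq_zero _ _ _ _ (hcls j)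
  rw [e1, e2, e3, e4, e5, e6, htot] at hsum
  exact absurd hsum (by decide)

end Literature.Computability.QuantumComplexity
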